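import Mathlib.Analysis.Convex.GaugeRescale
import Mathlib.Analysis.Convex.StdSimplex
import Mathlib.Analysis.Normed.Module.Convex
import Mathlib.Analysis.Normed.Module.RCLike.Real
import HarnessLib

/-!
# The standard simplex is homeomorphic to the cube, boundary onto boundary

Topic `Literature/AlgebraicTopology/Homotopy`. Elementary convex geometry absent from Mathlib in
bundled form: an explicit homeomorphism of pairs

  `(Δ^q, ∂Δ^q) ≅ (D^q, S^{q-1})`,

`Δ^q = stdSimplex ℝ (Fin (q + 1))` Mathlib's standard topological simplex (the model of singular
simplices, `TopCat.toSSet`), `∂Δ^q = {t | ∃ i, t i = 0}` its boundary, `D^q` the closed unit ball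
of `Fin q → ℝ` in the sup norm — the cube `[-1, 1]^q`, the model of the cells of Mathlib's CW
complexes and (up to the affine map `WhiteheadCW.cubeToBall`) of the cubes `I^q` on which
Mathlib's homotopy groups `π_q` are built — and `S^{q-1} = {‖y‖ = 1}` its boundary sphere.
Mathlib proves abstractly that two convex bodies are homeomorphic with boundaries corresponding
(`exists_homeomorph_image_interior_closure_frontier_eq_unitBall`); here the map is the explicit
gauge rescaling (`gaugeRescaleHomeomorph`) of the affine chart of `Δ^q` centred at its
barycentre, so that it is *radial*: barycentric homotheties of `Δ^q` correspond to homotheties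
of `D^q` (`SimplexBall.toBall_homothety`), as needed when cubical homotopy classes are compared
along it (homotopy addition lemma, `Literature/AlgebraicTopology/Homotopy/`).

* `SimplexBall.chart q : (Fin (q+1) → ℝ) → (Fin q → ℝ)`, `t ↦ (t₁ - c, …, t_q - c)`,
  `c = 1/(q+1)`, with inverse `SimplexBall.unchart q` on the hyperplane `∑ tᵢ = 1`; the convex
  body `SimplexBall.body q = chart '' Δ^q`, a neighbourhood of `0`, and its frontier.
* `SimplexBall.toBall q : stdSimplex ℝ (Fin (q + 1)) ≃ₜ Metric.closedBall (0 : Fin q → ℝ) 1`,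
  with `SimplexBall.toBall_mem_sphere_iff : ↑(toBall q t) ∈ sphere 0 1 ↔ ∃ i, t i = 0` and
  the radial property `SimplexBall.toBall_homothety`.

Everything is proved; no named facts. (Hatcher, *Algebraic Topology* (2002), proof of
Prop. 2.21 / §2.1: "the standard simplex … homeomorphic to a disk"; the gauge construction is
that of Mathlib's `Mathlib/Analysis/Convex/GaugeRescale.lean`.)

## References

* A. Hatcher, *Algebraic Topology*, CUP (2002), §2.1 (singular simplices; `Δⁿ` is a disc).
  [HatcherAT2002]
-/

noncomputable section

open Set Metric Topology Function Bornology Filter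

namespace Literature.AlgebraicTopology.Homotopy

namespace SimplexBall

variable (q : ℕ)

/-! ### The affine chart of the simplex centred at the barycentre -/

/-- The barycentric coordinate value `c = 1 / (q + 1)`. [folklore] -/
def c : ℝ := 1 / ((q : ℝ) + 1)

/-- `0 < c`. [folklore] -/
theorem c_pos : 0 < c q := by unfold c; positivity

/-- `q · c < 1` (indeed `= q/(q+1)`). [folklore] -/
theorem q_mul_c_lt_one : (q : ℝ) * c q < 1 := by
  unfold c
  rw [mul_one_div, div_lt_one (by positivity)]
  linarith

/-- `c ≤ 1`. [folklore] -/
theorem c_le_one : c q ≤ 1 := by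
  unfold c
  rw [div_le_one (by positivity)]
  linarith

/-- The affine chart: drop the `0`-th barycentric coordinate and centre at the barycentre.
[folklore] -/
def chart (t : Fin (q + 1) → ℝ) : Fin q → ℝ := fun i => t i.succ - c q

/-- The inverse chart (onto the hyperplane `∑ tᵢ = 1`). [folklore] -/
def unchart (x : Fin q → ℝ) : Fin (q + 1) → ℝ :=
  Fin.cases (1 - ∑ i, (x i + c q)) fun i => x i + c q

/-- `unchart` at the vertex `0`. [folklore] -/
@[simp] theorem unchart_zero (x : Fin q → ℝ) : unchart q x 0 = 1 - ∑ i, (x i + c q) := by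
  simp [unchart]

/-- `unchart` at a successor index. [folklore] -/
@[simp] theorem unchart_succ (x : Fin q → ℝ) (i : Fin q) : unchart q x i.succ = x i + c q := by
  simp [unchart]

/-- The chart is continuous (indeed affine). [folklore] -/
@[fun_prop]
theorem continuous_chart : Continuous (chart q) :=
  continuous_pi fun i => (continuous_apply i.succ).sub continuous_const

/-- The inverse chart is continuous (indeed affine). [folklore] -/
@[fun_prop]
theorem continuous_unchart : Continuous (unchart q) := by
  refine continuous_pi fun i => ?_
  refine Fin.cases ?_ (fun j => ?_) i
  · simp only [unchart_zero]
    fun_prop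
  · simp only [unchart_succ]
    fun_prop

/-- `chart ∘ unchart = id`. [folklore] -/
@[simp] theorem chart_unchart (x : Fin q → ℝ) : chart q (unchart q x) = x := by
  funext i
  simp [chart]

/-- `unchart ∘ chart = id` on the hyperplane `∑ tᵢ = 1`. [folklore] -/
theorem unchart_chart {t : Fin (q + 1) → ℝ} (ht : ∑ i, t i = 1) : unchart q (chart q t) = t := by
  funext i
  refine Fin.cases ?_ (fun j => ?_) i
  · rw [unchart_zero]
    rw [Fin.sum_univ_succ] at ht
    have : ∑ j : Fin q, (chart q t j + c q) = ∑ j : Fin q, t j.succ :=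
      Finset.sum_congr rfl fun j _ => by simp [chart]
    rw [this]
    linarith
  · rw [unchart_succ]
    simp [chart]

/-- The chart is linear up to the translation by the barycentre: `chart` of a barycentric
homothety `c • 1 + λ • (t - c • 1)` (centre the barycentre `(c, …, c)`, ratio `λ`) is `λ • chart t`.
[folklore] -/
theorem chart_homothety (t : Fin (q + 1) → ℝ) (lam : ℝ) :
    chart q (fun i => c q + lam * (t i - c q)) = lam • chart q t := by
  funext i
  simp [chart, mul_sub]

/-- The chart sends the barycentre to `0`. [folklore] -/
theorem chart_barycentre : chart q (fun _ => c q) = 0 := by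
  funext i; simp [chart]

/-! ### The convex body `chart '' Δ^q` -/

/-- The image of the simplex under the chart: `{x | xᵢ + c ≥ 0, ∑ (xᵢ + c) ≤ 1}`. [folklore] -/
def body : Set (Fin q → ℝ) := {x | (∀ i, 0 ≤ x i + c q) ∧ ∑ i, (x i + c q) ≤ 1}

variable {q}

/-- Unfolding of `body`. [folklore] -/
theorem mem_body {x : Fin q → ℝ} : x ∈ body q ↔ (∀ i, 0 ≤ x i + c q) ∧ ∑ i, (x i + c q) ≤ 1 :=
  Iff.rfl

/-- `x ∈ body ↔ unchart x ∈ Δ^q`. [folklore] -/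
theorem mem_body_iff_unchart_mem {x : Fin q → ℝ} :
    x ∈ body q ↔ unchart q x ∈ stdSimplex ℝ (Fin (q + 1)) := by
  rw [mem_body, stdSimplex, mem_setOf_eq, Fin.forall_fin_succ, Fin.sum_univ_succ]
  simp only [unchart_zero, unchart_succ, sub_nonneg, sub_add_cancel, and_true]
  exact and_comm

/-- The chart maps the simplex into the body. [folklore] -/
theorem chart_mem_body {t : Fin (q + 1) → ℝ} (ht : t ∈ stdSimplex ℝ (Fin (q + 1))) :
    chart q t ∈ body q := by
  rw [mem_body_iff_unchart_mem, unchart_chart q ht.2]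
  exact ht

/-- The body is the image of the simplex under the chart. [folklore] -/
theorem image_chart_stdSimplex : chart q '' stdSimplex ℝ (Fin (q + 1)) = body q := by
  refine Subset.antisymm ?_ ?_
  · rintro _ ⟨t, ht, rfl⟩
    exact chart_mem_body ht
  · intro x hx
    exact ⟨unchart q x, mem_body_iff_unchart_mem.1 hx, chart_unchart q x⟩

variable (q)

/-- The body is convex. [folklore] -/
theorem convex_body : Convex ℝ (body q) := by
  have h1 : body q = (⋂ i, {x : Fin q → ℝ | -c q ≤ x i}) ∩ {x | ∑ i, x i ≤ 1 - q * c q} := by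
    ext x
    simp only [mem_body, mem_inter_iff, mem_iInter, mem_setOf_eq, Finset.sum_add_distrib,
      Finset.sum_const, Finset.card_univ, Fintype.card_fin, nsmul_eq_mul]
    constructor
    · rintro ⟨h, h'⟩; exact ⟨fun i => by linarith [h i], by linarith⟩
    · rintro ⟨h, h'⟩; exact ⟨fun i => by linarith [h i], by linarith⟩
  rw [h1]
  refine Convex.inter (convex_iInter fun i => ?_) ?_
  · exact convex_halfSpace_ge (IsLinearMap.mk (fun x y => rfl) (fun a x => rfl)) _
  · exact convex_halfSpace_le (IsLinearMap.mk (fun x y => Finset.sum_add_distrib)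
      (fun a x => by simp [Finset.mul_sum])) _

/-- The body is closed. [folklore] -/
theorem isClosed_body : IsClosed (body q) := by
  have h1 : body q = (⋂ i, {x : Fin q → ℝ | 0 ≤ x i + c q}) ∩ {x | ∑ i, (x i + c q) ≤ 1} := by
    ext x; simp [mem_body]
  rw [h1]
  refine IsClosed.inter (isClosed_iInter fun i => isClosed_le continuous_const (by fun_prop)) ?_
  exact isClosed_le (by fun_prop) continuous_const

/-- The open core of the body (strict inequalities). [folklore] -/
def core : Set (Fin q → ℝ) := {x | (∀ i, 0 < x i + c q) ∧ ∑ i, (x i + c q) < 1}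

/-- The core is open. [folklore] -/
theorem isOpen_core : IsOpen (core q) := by
  have h1 : core q = (⋂ i, {x : Fin q → ℝ | 0 < x i + c q}) ∩ {x | ∑ i, (x i + c q) < 1} := by
    ext x; simp [core]
  rw [h1]
  refine IsOpen.inter (isOpen_iInter_of_finite fun i => isOpen_lt continuous_const (by fun_prop)) ?_
  exact isOpen_lt (by fun_prop) continuous_const

/-- The core lies in the body. [folklore] -/
theorem core_subset_body : core q ⊆ body q := fun _ hx => ⟨fun i => (hx.1 i).le, hx.2.le⟩

/-- `0` (the barycentre) lies in the core. [folklore] -/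
theorem zero_mem_core : (0 : Fin q → ℝ) ∈ core q := by
  refine ⟨fun i => by simpa using c_pos q, ?_⟩
  simp only [Pi.zero_apply, zero_add, Finset.sum_const, Finset.card_univ, Fintype.card_fin,
    nsmul_eq_mul]
  exact q_mul_c_lt_one q

/-- The body is a neighbourhood of `0`. [folklore] -/
theorem body_mem_nhds_zero : body q ∈ 𝓝 (0 : Fin q → ℝ) :=
  Filter.mem_of_superset ((isOpen_core q).mem_nhds (zero_mem_core q)) (core_subset_body q)

/-- The body lies in the closed unit ball (sup norm). [folklore] -/
theorem body_subset_closedBall : body q ⊆ closedBall (0 : Fin q → ℝ) 1 := by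
  intro x hx
  rw [mem_closedBall_zero_iff, pi_norm_le_iff_of_nonneg zero_le_one]
  intro i
  rw [Real.norm_eq_abs, abs_le]
  have h1 := hx.1 i
  have h2 : x i + c q ≤ ∑ j, (x j + c q) :=
    Finset.single_le_sum (fun j _ => hx.1 j) (Finset.mem_univ i)
  constructor <;> linarith [hx.2, c_pos q, c_le_one q]

/-- The body is bounded. [folklore] -/
theorem isBounded_body : IsBounded (body q) :=
  isBounded_closedBall.subset (body_subset_closedBall q)

/-- The interior of the body is the core. [folklore] -/
theorem interior_body : interior (body q) = core q := by
  refine Subset.antisymm ?_ ((isOpen_core q).subset_interior_iff.2 (core_subset_body q))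
  intro x hx
  rw [mem_interior_iff_mem_nhds, Metric.mem_nhds_iff] at hx
  obtain ⟨ε, hε, hball⟩ := hx
  have hε2 : 0 < ε / 2 := half_pos hε
  refine ⟨fun i => ?_, ?_⟩
  · -- move in the direction `-eᵢ`
    have hy : x - Pi.single i (ε / 2) ∈ body q := by
      refine hball ?_
      rw [mem_ball, dist_eq_norm, sub_sub_cancel_left, norm_neg, Pi.norm_single, Real.norm_eq_abs,
        abs_of_pos hε2]
      exact half_lt_self hε
    have h1 := hy.1 i
    simp only [Pi.sub_apply, Pi.single_eq_same] at h1
    linarith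
  · -- move in the direction `+e₀` (any coordinate); if `q = 0` the sum is empty
    rcases Nat.eq_zero_or_pos q with hq | hq
    · subst hq
      simp [c]
    · set i₀ : Fin q := ⟨0, hq⟩
      have hy : x + Pi.single i₀ (ε / 2) ∈ body q := by
        refine hball ?_
        rw [mem_ball, dist_eq_norm, add_sub_cancel_left, Pi.norm_single, Real.norm_eq_abs,
          abs_of_pos hε2]
        exact half_lt_self hε
      have h1 := hy.2
      have h2 : ∑ j, ((x + Pi.single i₀ (ε / 2) : Fin q → ℝ) j + c q) =
          (∑ j, (x j + c q)) + ε / 2 := by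
        simp only [Pi.add_apply, Finset.sum_add_distrib, Finset.sum_pi_single', Finset.mem_univ,
          if_true]
        ring
      rw [h2] at h1
      linarith

/-- The frontier of the body: the points of the body where some defining inequality is an
equality, i.e. (through `unchart`) where some barycentric coordinate vanishes. [folklore] -/
theorem frontier_body_eq : frontier (body q) =
    {x | x ∈ body q ∧ ((∃ i, x i + c q = 0) ∨ ∑ i, (x i + c q) = 1)} := by
  rw [frontier, (isClosed_body q).closure_eq, interior_body]
  ext x
  rw [Set.mem_sdiff, mem_setOf_eq]
  refine and_congr_right fun hx => ?_
  simp only [core, mem_setOf_eq, not_and_or, not_forall, not_lt]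
  constructor
  · intro h
    rcases h with ⟨i, hi⟩ | h
    · exact Or.inl ⟨i, le_antisymm hi (hx.1 i)⟩
    · exact Or.inr (le_antisymm hx.2 h)
  · intro h
    rcases h with ⟨i, hi⟩ | h
    · exact Or.inl ⟨i, hi.le⟩
    · exact Or.inr h.ge

/-- Through the chart, the frontier of the body corresponds to the boundary of the simplex:
for `t ∈ Δ^q`, `chart t ∈ frontier (body)` iff some `tᵢ = 0`. [folklore] -/
theorem chart_mem_frontier_body_iff {t : Fin (q + 1) → ℝ} (ht : t ∈ stdSimplex ℝ (Fin (q + 1))) :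
    chart q t ∈ frontier (body q) ↔ ∃ i, t i = 0 := by
  rw [frontier_body_eq]
  simp only [mem_setOf_eq, chart_mem_body ht, true_and]
  have h1 := ht.2
  rw [Fin.sum_univ_succ] at h1
  have hsum : (∑ i : Fin q, t i.succ = 1) ↔ t 0 = 0 := by
    constructor <;> intro h <;> linarith
  simp only [chart, sub_add_cancel]
  rw [hsum, Fin.exists_fin_succ]
  tauto

/-! ### The homeomorphism -/

/-- The gauge rescaling of `Fin q → ℝ` carrying the body onto the closed unit ball (Mathlib's
`gaugeRescaleHomeomorph`). [folklore] -/
def rescale : (Fin q → ℝ) ≃ₜ (Fin q → ℝ) :=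
  gaugeRescaleHomeomorph (body q) (closedBall 0 1) (convex_body q) (body_mem_nhds_zero q)
    (NormedSpace.isVonNBounded_of_isBounded ℝ (isBounded_body q)) (convex_closedBall 0 1)
    (closedBall_mem_nhds 0 one_pos) (NormedSpace.isVonNBounded_closedBall ℝ _ 1)

/-- The rescaling maps the body onto the closed unit ball. [folklore] -/
theorem image_rescale_body : rescale q '' body q = closedBall 0 1 := by
  have h := image_gaugeRescaleHomeomorph_closure (convex_body q) (body_mem_nhds_zero q)
    (NormedSpace.isVonNBounded_of_isBounded ℝ (isBounded_body q)) (convex_closedBall 0 1)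
    (closedBall_mem_nhds (0 : Fin q → ℝ) one_pos) (NormedSpace.isVonNBounded_closedBall ℝ _ 1)
  rw [(isClosed_body q).closure_eq, isClosed_closedBall.closure_eq] at h
  exact h

/-- The rescaling maps the interior of the body onto the open unit ball. [folklore] -/
theorem image_rescale_interior_body : rescale q '' interior (body q) = ball 0 1 := by
  have h := image_gaugeRescaleHomeomorph_interior (convex_body q) (body_mem_nhds_zero q)
    (NormedSpace.isVonNBounded_of_isBounded ℝ (isBounded_body q)) (convex_closedBall 0 1)
    (closedBall_mem_nhds (0 : Fin q → ℝ) one_pos) (NormedSpace.isVonNBounded_closedBall ℝ _ 1)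
  rw [interior_closedBall (0 : Fin q → ℝ) one_ne_zero] at h
  exact h

/-- The rescaling maps the frontier of the body onto the unit sphere. [folklore] -/
theorem image_rescale_frontier_body : rescale q '' frontier (body q) = sphere 0 1 := by
  rw [frontier, (isClosed_body q).closure_eq, image_sdiff (rescale q).injective, image_rescale_body,
    image_rescale_interior_body, ← frontier_closedBall (0 : Fin q → ℝ) one_ne_zero, frontier,
    isClosed_closedBall.closure_eq, interior_closedBall (0 : Fin q → ℝ) one_ne_zero]

/-- The rescaling is positively homogeneous (it is radial). [folklore] -/
theorem rescale_smul {lam : ℝ} (hlam : 0 ≤ lam) (x : Fin q → ℝ) :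
    rescale q (lam • x) = lam • rescale q x :=
  gaugeRescale_smul _ _ hlam x

/-- A point of the body maps into the closed unit ball. [folklore] -/
theorem rescale_mem_closedBall {x : Fin q → ℝ} (hx : x ∈ body q) : rescale q x ∈ closedBall 0 1 := by
  rw [← image_rescale_body]; exact mem_image_of_mem _ hx

/-- A point of the closed unit ball comes from the body. [folklore] -/
theorem rescale_symm_mem_body {y : Fin q → ℝ} (hy : y ∈ closedBall (0 : Fin q → ℝ) 1) :
    (rescale q).symm y ∈ body q := by
  rw [← image_rescale_body] at hy
  obtain ⟨x, hx, rfl⟩ := hy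
  rwa [Homeomorph.symm_apply_apply]

/-- **The standard `q`-simplex is homeomorphic to the closed unit ball (cube) of `ℝ^q` in the sup
norm** — chart at the barycentre followed by the gauge rescaling. (Hatcher 2002, §2.1: `Δⁿ` is a
disc.) [cite: HatcherAT2002, §2.1] -/
def toBall : stdSimplex ℝ (Fin (q + 1)) ≃ₜ closedBall (0 : Fin q → ℝ) 1 where
  toFun t := ⟨rescale q (chart q t), rescale_mem_closedBall q (chart_mem_body t.2)⟩
  invFun y := ⟨unchart q ((rescale q).symm y), mem_body_iff_unchart_mem.1 (rescale_symm_mem_body q y.2)⟩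
  left_inv t := by
    apply Subtype.ext
    change unchart q ((rescale q).symm (rescale q (chart q t.1))) = t.1
    rw [Homeomorph.symm_apply_apply, unchart_chart q t.2.2]
  right_inv y := by
    apply Subtype.ext
    change rescale q (chart q (unchart q ((rescale q).symm y.1))) = y.1
    rw [chart_unchart, Homeomorph.apply_symm_apply]
  continuous_toFun := ((rescale q).continuous.comp ((continuous_chart q).comp continuous_subtype_val)).subtype_mk _
  continuous_invFun := ((continuous_unchart q).comp
    ((rescale q).symm.continuous.comp continuous_subtype_val)).subtype_mk _

/-- Unfolding of `toBall`. [folklore] -/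
theorem toBall_coe (t : stdSimplex ℝ (Fin (q + 1))) : (toBall q t : Fin q → ℝ) = rescale q (chart q t) :=
  rfl

/-- Unfolding of `toBall.symm`. [folklore] -/
theorem toBall_symm_coe (y : closedBall (0 : Fin q → ℝ) 1) :
    ((toBall q).symm y : Fin (q + 1) → ℝ) = unchart q ((rescale q).symm y) :=
  rfl

/-- **The homeomorphism carries the boundary of the simplex onto the boundary sphere**: `toBall t`
lies on the unit sphere iff some barycentric coordinate of `t` vanishes. [folklore] -/
theorem toBall_mem_sphere_iff (t : stdSimplex ℝ (Fin (q + 1))) :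
    (toBall q t : Fin q → ℝ) ∈ sphere (0 : Fin q → ℝ) 1 ↔ ∃ i, t i = 0 := by
  have ht : (⇑t : Fin (q + 1) → ℝ) ∈ stdSimplex ℝ (Fin (q + 1)) := t.2
  rw [toBall_coe, ← chart_mem_frontier_body_iff q ht, ← image_rescale_frontier_body]
  constructor
  · rintro ⟨x, hx, hxe⟩
    rwa [← (rescale q).injective hxe]
  · intro h
    exact mem_image_of_mem _ h

/-- The inverse homeomorphism carries the sphere onto the boundary: for `y` in the closed ball,
some barycentric coordinate of `toBall.symm y` vanishes iff `‖y‖ = 1`. [folklore] -/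
theorem exists_toBall_symm_apply_eq_zero_iff (y : closedBall (0 : Fin q → ℝ) 1) :
    (∃ i, ((toBall q).symm y : Fin (q + 1) → ℝ) i = 0) ↔ (y : Fin q → ℝ) ∈ sphere (0 : Fin q → ℝ) 1 := by
  rw [← toBall_mem_sphere_iff, Homeomorph.apply_symm_apply]

/-- The barycentric homothety of ratio `λ ∈ [0, 1]` keeps the simplex. [folklore] -/
theorem homothety_mem_stdSimplex {t : Fin (q + 1) → ℝ} (ht : t ∈ stdSimplex ℝ (Fin (q + 1)))
    {lam : ℝ} (h0 : 0 ≤ lam) (h1 : lam ≤ 1) :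
    (fun i => c q + lam * (t i - c q)) ∈ stdSimplex ℝ (Fin (q + 1)) := by
  refine ⟨fun i => ?_, ?_⟩
  · have := ht.1 i
    have hc := c_pos q
    nlinarith
  · have hc1 : ((q : ℝ) + 1) * c q = 1 := by unfold c; field_simp
    rw [Finset.sum_add_distrib, Finset.sum_const, Finset.card_univ, Fintype.card_fin,
      ← Finset.mul_sum, Finset.sum_sub_distrib, ht.2, Finset.sum_const, Finset.card_univ,
      Fintype.card_fin]
    simp only [nsmul_eq_mul]
    push_cast
    linear_combination (1 - lam) * hc1

/-- **Radiality**: the homeomorphism intertwines the barycentric homothety of ratio `λ ≥ 0` on the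
simplex with the homothety `y ↦ λ y` of the ball (whenever the former stays in the simplex).
[folklore] -/
theorem toBall_homothety (t : stdSimplex ℝ (Fin (q + 1))) {lam : ℝ} (h0 : 0 ≤ lam)
    (hmem : (fun i => c q + lam * ((t : Fin (q + 1) → ℝ) i - c q)) ∈ stdSimplex ℝ (Fin (q + 1))) :
    (toBall q ⟨_, hmem⟩ : Fin q → ℝ) = lam • (toBall q t : Fin q → ℝ) := by
  rw [toBall_coe, toBall_coe]
  show rescale q (chart q fun i => c q + lam * ((t : Fin (q + 1) → ℝ) i - c q)) = _
  rw [chart_homothety, rescale_smul q h0]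

/-- The barycentre goes to the centre of the ball. [folklore] -/
theorem toBall_barycentre (h : (fun _ : Fin (q + 1) => c q) ∈ stdSimplex ℝ (Fin (q + 1))) :
    (toBall q ⟨fun _ => c q, h⟩ : Fin q → ℝ) = 0 := by
  rw [toBall_coe]
  show rescale q (chart q fun _ => c q) = 0
  rw [chart_barycentre]
  have := rescale_smul q le_rfl (0 : Fin q → ℝ)
  rwa [zero_smul, zero_smul] at this

/-- The barycentre `(c, …, c)` is a point of the simplex. [folklore] -/
theorem barycentre_mem_stdSimplex : (fun _ : Fin (q + 1) => c q) ∈ stdSimplex ℝ (Fin (q + 1)) := by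
  refine ⟨fun i => (c_pos q).le, ?_⟩
  simp only [Finset.sum_const, Finset.card_univ, Fintype.card_fin, nsmul_eq_mul]
  unfold c
  push_cast
  field_simp

end SimplexBall

end Literature.AlgebraicTopology.Homotopy

end
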